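import Summits.CriticalPhenomena.Ising3DConformalLimit.Theses.SubPtolemyInterlacing
import Summits.CriticalPhenomena.Ising3DConformalLimit.Theorems.SubPtolemyFloor.Negative.ExponentWindow
import Summits.CriticalPhenomena.Ising3DConformalLimit.Theorems.Interlacing.Negative.LoadBearingAnalysis
import Summits.CriticalPhenomena.Ising3DConformalLimit.Theorems.Interlacing.Negative.RegionCounterexample
import Summits.CriticalPhenomena.Ising3DConformalLimit.Theorems.Interlacing.Negative.RegionCounterexampleZ3
import Summits.CriticalPhenomena.Ising3DConformalLimit.Theorems.Interlacing.Negative.BalancedVsAllGaps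

/-!
# Disproof of `Interlacing` (item stmt-CriticalPhenomena-15702) — standing crux disprover's work file

Crux (route `SubPtolemyInterlacing`, rank 2): for all gaps `a b c ≥ 1`, with `p k = k·e₁ ∈ ℤ³`,
`S₄(p0,pa,p(a+b),p(a+b+c)) · G(p0,p(a+b)) G(pa,p(a+b+c)) ≤ G(p0,pa) G(p(a+b),p(a+b+c)) · G(p0,p(a+b+c)) G(pa,p(a+b))`
for the critical plus state `criticalCorr 3` (sub-Ptolemy / interlacing inequality, "SPC").

## Findings (cycle 1)

* **No in-Lean refutation is possible in principle at present**: `criticalCorr 3 n x` is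
  `limUnder` of finite-volume Gibbs expectations at `β = criticalBeta 3 = sInf {β ≥ 0 | m*(β) > 0}`;
  no certified numerics for `β_c(3)` or for critical correlations exist (tree or print), so `¬ Interlacing`
  could only come from a STRUCTURAL argument. None found (§E).
* §A  The side conditions `1 ≤ a`, `1 ≤ b`, `1 ≤ c` are NOT load-bearing: at a zero gap the inequality is an
  EQUALITY (`σ² = 1`, `interlacingAllGaps_iff`). Consequently there is no `_false_without_` lemma for them, and
  the inequality is TIGHT (saturated) on the boundary of the gap octant (`not_interlacingStrictAllGaps`).
* §C1 The only genuinely load-bearing "hypothesis" is the law itself (critical n.n. Ising on `ℤ³`). Its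
  Gaussian caricature FAILS: for a Wick law with scale-free two-point function `n^{-s}` the inequality at the
  Ptolemy-balanced quadruple `(0,2,3,6)·e₁` holds iff `log₂(1+√2) ≤ s` (`wickSPC_pow_balanced_iff`); so it
  fails for the `ℤ³`-GFF exponent `s = 1` and for EVERY `s = 2Δ` in the window `2Δ < log₂(1+√2)` that the
  sibling crux `SubPtolemyFloor` asks for (`not_wickSPC_pow_of_lt_threshold`), and holds at `s = 2`
  (`d ≥ 4` mean-field exponent). Moral for provers: no argument valid for all RP / GKS / Gaussian-dominated
  laws can prove the crux; exactly in the regime where the route pays off, SPC is an anti-Gaussian statement.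
* §C2 Calibration on trees: for a multiplicative (Markov-chain) law `G(i,j) = t^{|i-j|}`, `S₄ = t^{a+c}`, SPC
  is an IDENTITY (`chain_spc_eq`), while the same inequality with the adjacent pairing `(12)(34)` in the
  penalised slot is FALSE (`not_chain_adjacentPenalised`): the interlaced labelling is load-bearing.
* §E  Numerical counterexample search (kit jobs, ids below) — see the docstring of `numerics_summary`.

Everything in §A–§C is sorry-free; §E records near-misses as prose only.

## Findings (gen 2 — standing disprover `refuter-cdisprove-stmt-CriticalPhenomena-15702-g2`, 2026-08-17)

Landed negative lemmas (all sorry-free, standard axioms), importable by every seat: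
`Theorems/Interlacing/Negative/LoadBearingAnalysis.lean` (gen 1, p129331/p129684 — §A–§D below in tree form),
`…/RegionCounterexample.lean` (p139593), `…/RegionCounterexampleZ3.lean` (p140065), `…/BalancedVsAllGaps.lean`
(p140878). This file imports them; §F–§H index what they say and add the glue.

* §F **SPC is NOT a finite-graph / region-general correlation inequality.** On the 10-site region
  `Λ_Z ⊂ ℤ² × {0} ⊂ ℤ³` (axis `0, e₁, 2e₁, 3e₁`; an upper bypass `(0,1),(1,1),(2,1)` over `[x₁,x₃]`; a lower bypass
  `(1,-1),(2,-1),(3,-1)` under `[x₂,x₄]`; free b.c.) the interlacing inequality at gaps `(1,1,1)` is REVERSED at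
  `tanh β ∈ {1/100, 1/5, 7/32}` (kernel-exact rationals, `gksExpect_zRegion_interlacing_reversed*`), numerically at
  every `t = tanh β ∈ (0,1)` with `ρ − 1 = t⁴ + O(t⁶)` (`ρ := S₄P₂/(P₁P₃)`; `+1.32·10⁻³` at `t = 0.2183 ≈ tanh β_c`); in
  the tree's own finite-volume language: `regionGeneral_boxSPC_false` below (= `not_interlacing_freeRegion`:
  `isingExpect (zdGraph 3) Λ β 0 .free`). Pendant axis paths attached to `x₁`, `x₄` factor out of every ratio, so the
  SAME violation sits at every gap triple `(a, 1, c)` — in particular at the balanced shape `(2,1,3)` of the lead's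
  restated crux: `Λ_B` = `Λ_Z + e₁` with the pendant axis sites `0, 5e₁, 6e₁` (13 sites, 16 bonds), quadruple `(0,2e₁,3e₁,6e₁)`,
  `ρ − 1 = +1.01·10⁻³` at `tanh β = 1/5` (`+1.32·10⁻³` at `t = 0.2183`) — CERTIFIED in
  `Theorems/Interlacing/Negative/RegionCounterexampleBalanced.lean` (p141948: `not_interlacingBalanced_freeRegion`, the
  region-general form of the balanced box inequality in the tree's `isingExpect (zdGraph 3) Λ β 0 .free` language; the eight
  `2¹³`-term integer spin sums by `native_decide` — computational, re-certified by elaboration — because `decide +kernel` exceeds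
  the farm's kernel memory budget at this size; everything else kernel-checked) — and staggered bypass decorations violate at `(1,2,1), (1,3,1), (2,1,2), (2,2,2),
  (3,3,3), (4,1,4), (4,2,6)` for all sampled `t ∈ [0.05, 0.7]` (`ρ − 1` up to `2.4·10⁻²`). In every violating
  region found at `t ≤ 0.3` the axis two-point function is log-CONCAVE at the quadruple (`P₃ < P₂`: the bypasses
  boost the crossing pair `G₁₃, G₂₄`); from `t ≈ 0.4` on there are regions — `Λ_R := Λ_Z ∪ ([x₁,x₄] + e₃)`, 14 sites —
  with `u, t ≥ 1`, `(u−1)(t−1) < 2` AND `ρ > 1` (`u−1 = 0.52`, `t−1 = 5.7·10⁻³`, `ρ−1 = +1.6·10⁻³` at `t = 1/2`): the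
  engine's displayed two-point inputs REALISED by a genuine Ising region still do not give SPC (exact integers
  off-line, bond parameter `(b + a σσ) = (2 + σσ)` on the 20 bonds `uR = ![0,1,2,4,5,7,8,0,1,2,1,2,3,10,11,12,0,1,2,3]`,
  `vR = ![1,2,3,5,6,8,9,4,5,6,7,8,9,11,12,13,10,11,12,13]` of `Fin 14`: `Z = 29600251904`, `Z·S₄ = 14595129344`,
  `Z·G₁₂ = Z·G₃₄ = 20709376000`, `Z·G₁₃ = Z·G₂₄ = 16789274624`, `Z·G₁₄ = 12339773440`, `Z·G₂₃ = 22974300160`; the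
  `decide +kernel` certificate of even ONE of these 2¹⁴-term sums fails on the farm with "(kernel) excessive memory
  consumption", so `Λ_R` stays uncertified — `native_decide`/`--computational` would be needed).
  CONSEQUENCES for `stub_engine` ≡ `stub_cageScreening` (and the prepared `stub_engineBalanced`): (i) no
  region-insensitive argument can prove them — no current injection / coupling valid on every finite graph, no
  region-monotone scheme, nothing built only from `u,t ≥ 1` + Lebowitz + GKS + switching (all inherited by `Λ_Z`);
  (ii) the proof must use the translation / reflection structure of the full box QUANTITATIVELY (HT picture: in `ℤ³`
  `P₃ − P₂ = 4ac·t^{a+2b+c+2} + …`, the `4ac` counting sideways translates of `[x₂−e₁, x₃+e₁]` — the order-`t²`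
  log-convexity slack that `Λ_Z` lacks, while `S₄ − P₁` enters only at relative order `t⁴`); (iii) free-boundary SPC
  is not volume-monotone (`Λ_Z ⊂ Λ_4 = {−4..4}³`, where MC gives `ρ(1,1,1) = 0.86`, kit j020588); (iv) `β_c`
  plays no role in the failure — the content of the stub is "box geometry", not criticality, at small gaps.
* §G **Balanced family versus all gaps** (the lead's `disprover-wanted`, cycle c1-1). Merging form
  (`spc_iff_merging`): with `S₄ = P₁+P₂+P₃ − 2P₂·I` (box switching, `I` = merging probability of the two interlaced
  sourced currents) SPC is `2P₂²(1 − I) ≤ (P₁−P₂)(P₃−P₂)`, so EVERY instance with `I < 1` needs `u = P₁/P₂ > 1` AND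
  `t = P₃/P₂ > 1` STRICTLY and quantitatively (`spc_forces_strict`); MMS / reflection positivity give only `≥ 1`, and
  no landed or printed fact bounds `t − 1` below at `β_c(3)` at any scale. `balancedFamily_insufficient`
  (= landed `not_allGaps_of_balanced_and_twoPointFacts`): ONE two-point function with every landed property
  (`G 0 = 1`, `0 < G ≤ 1`, antitone, the MMS shape of `stub_monotone`, the GLOBAL log-convexity of `stub_logConvex`,
  the critical envelope `1/(3n²) ≤ G ≤ 1/n`) and ONE reversal-symmetric four-point assignment obeying Griffiths II,
  Lebowitz and the switching range, with merging probability `9/10` at EVERY shape, satisfies SPC at all balanced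
  shapes `(2N,N,3N)`, `N ≥ 1`, and violates it at `(1,1,1)` (model: geometric head `3^{-n}`, `n ≤ 3`, tail `1/(3n²)`;
  `t(1,1,1) = 1`). So the restated crux (candidates A/B of `Lines/Sketch_restate.lean`) is STRICTLY weaker in the
  abstract class, and what the dropped instances add is quantitative strict log-convexity at the scale of the gaps —
  not a second four-point mechanism. Read forward, the balanced stub itself needs `(u_L−1)(t_L−1) ≥ 2(1−I_L) > 0`
  eventually in `L`, i.e. STRICT box log-convexity `G_L(6N)G_L(N) > G_L(3N)G_L(4N)` with a uniform margin — unproved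
  (true in the scaling limit iff `G` is regularly varying, `t_N → 2^{2Δ} ≈ 2.05`). The regions of §F make the point
  quantitatively: in `Λ_B` (balanced, `tanh β = 1/5`) the interlaced currents MERGE with probability `I = 0.99904` and in
  `Λ_R` (`tanh β = 1/2`) with `I = 0.99730`, yet SPC fails, because `(u−1)(t−1)/2 = −0.0092` resp. `+0.0015` is below
  `1 − I` (`ι* = 1.0092` resp. `0.9985`): a merging floor is necessary, the two-point slack is where regions and boxes
  differ.
* §G′ **Cross-ratio profile of the Gaussian threshold** (`wickSPC_iff_defects`, `wickSPC_iff_ut`, `spc_iff_iotaStar`,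
  `one_sub_crossRatio`; the extremality claim is prose): for the pure power law
  `n^{-s}` one has `u = z^{-s}`, `t = (1−z)^{-s}` with the cross-ratio `z = ac/((a+b)(b+c))`,
  `1 − z = b(a+b+c)/((a+b)(b+c))`, so the threshold `ι*(z) = 1 − (z^{-s}−1)((1−z)^{-s}−1)/2` depends on `z` only, is
  symmetric under `z ↔ 1−z`, `≡ 1/2` at `s = 1`, and has a local MAXIMUM at `z = ½` iff `2^s > 1 + s` iff `s > 1`
  (second-order coefficient `−s·2^s(2^s − 1 − s)·w²`, `z = (1−w)/2`); numerically it is the global maximum at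
  `s = 2Δ_σ = 1.036`: `ι*(½) = 0.4482, ι*(0.45) = 0.4480, ι*(0.4) = 0.4476, ι*(0.3) = 0.445, ι*(0.1) = 0.431,
  ι*(0.01) = 0.388`, `→ −∞` as `z → 0`. So for a scale-free law the balanced shapes ARE the hardest cross-ratio; the
  bands `z → 0, 1` need a SMALLER merging floor while physically `1 − I×(n,b,n) → 0` (like `(n/b)^{2Δ_ε−4Δ_σ} =
  (n/b)^{0.76}`); the lead's "`Δ_ε > 1`" is the ρ-currency name of that comparison, not an extra four-point problem —
  the lattice raises `ι*` above `ι*(½)` only at a few small shapes (`ι*(1,1,1) = 0.51`, lead's table, because `G(1)` is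
  anomalously large). What the bands DO carry is §G: strict log-convexity at relative size `≍ s·n²/b²`.
* §H Targets — line `Sketch` (+ prepared `Sketch_balanced`, `Sketch_restate`): no stub broken; `stub_engine` IS the
  crux in the box; joint sufficiency honest (gen 1 §D). The restated `stub_engineBalanced` inherits §F (region
  sensitivity already at `(2,1,3)`) and §G. NOT REFUTABLE at any `N` with present tools: no certified numerics or
  convergent expansion AT `β_c(3)`; MC (lead: kit j020588 boxes `L ≤ 16`, j020648 tori 33/65): `I× = 0.87–0.96` vs
  `ι* = 0.30–0.33` at `N = 1`, `ρ(2,1,3) = 0.72–0.78`, continuum `ρ(½) ≈ 0.85`, `I× ≈ 0.755` vs `0.448`; j022368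
  (`N ≤ 4`) pending on the lead's side. The Gaussian threshold of the restated crux is EXACTLY the sibling crux
  `SubPtolemyFloor`'s `2Δ ≥ log₂(1+√2)` (gen 1 §C1) — the restatement loses none of the anti-Gaussian content.
-/

noncomputable section

namespace Summit.CriticalPhenomena.Ising3DConformalLimit.Cruxes.Interlacing.Disproof

open Literature.Probability.LatticeModels Filter Topology MeasureTheory
open Summit.CriticalPhenomena.Ising3DConformalLimit.Theses

/-! ### §A Coincident points: the gap hypotheses are decoration -/

/-- The axis point `k·e₁ ∈ ℤ³` (the spelling of the route decl). -/
abbrev ax (k : ℕ) : Site 3 := (k : ℤ) • (Pi.single 0 1 : Site 3)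

/-- `⟨σ_x σ_x σ_q σ_r⟩ = ⟨σ_q σ_r⟩` (`σ_x² = 1`; `criticalCorr` is an expectation of spin MONOMIALS). -/
theorem corr4_eq01 (d : ℕ) (x q r : Site d) :
    criticalCorr d 4 ![x, x, q, r] = criticalCorr d 2 ![q, r] := by
  simp only [criticalCorr]
  congr 1
  funext s
  simp [spinMonomial, Fin.prod_univ_four, Fin.prod_univ_two]

/-- `⟨σ_x σ_q σ_q σ_r⟩ = ⟨σ_x σ_r⟩`. -/
theorem corr4_eq12 (d : ℕ) (x q r : Site d) :
    criticalCorr d 4 ![x, q, q, r] = criticalCorr d 2 ![x, r] := by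
  simp only [criticalCorr]
  congr 1
  funext s
  simp only [spinMonomial, Fin.prod_univ_four, Fin.prod_univ_two, Fin.isValue, Matrix.cons_val_zero,
    Matrix.cons_val_one, Matrix.cons_val]
  have h := spinAt_mul_self q s
  linear_combination (spinAt x s * spinAt r s) * h

/-- `⟨σ_x σ_q σ_r σ_r⟩ = ⟨σ_x σ_q⟩`. -/
theorem corr4_eq23 (d : ℕ) (x q r : Site d) :
    criticalCorr d 4 ![x, q, r, r] = criticalCorr d 2 ![x, q] := by
  simp only [criticalCorr]
  congr 1
  funext s
  simp only [spinMonomial, Fin.prod_univ_four, Fin.prod_univ_two, Fin.isValue, Matrix.cons_val_zero,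
    Matrix.cons_val_one, Matrix.cons_val]
  have h := spinAt_mul_self r s
  linear_combination (spinAt x s * spinAt q s) * h

/-- `⟨σ_x σ_x⟩ = 1`: the box expectations are probability integrals of the constant `1`. -/
theorem corr2_self (d : ℕ) (x : Site d) : criticalCorr d 2 ![x, x] = 1 := by
  have hmono : spinMonomial ![x, x] = fun _ : SpinConfig (Site d) => (1 : ℝ) := by
    funext s
    simp [spinMonomial, Fin.prod_univ_two]
  have hconst : (fun L : ℕ => isingExpect (zdGraph d) (box d L) (criticalBeta d) 0 .plus
      (spinMonomial ![x, x])) = fun _ => (1 : ℝ) := by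
    funext L
    rw [hmono]
    simp [isingExpect]
  have ht : Tendsto (fun _ : ℕ => (1 : ℝ)) atTop (𝓝 1) := tendsto_const_nhds
  simp only [criticalCorr, plusExpect]
  rw [hconst]
  exact ht.limUnder_eq

/-- The crux with the three gap hypotheses `1 ≤ a`, `1 ≤ b`, `1 ≤ c` DROPPED. -/
def InterlacingAllGaps : Prop :=
  ∀ a b c : ℕ,
    criticalCorr 3 4 ![ax 0, ax a, ax (a + b), ax (a + b + c)] *
        (criticalCorr 3 2 ![ax 0, ax (a + b)] * criticalCorr 3 2 ![ax a, ax (a + b + c)]) ≤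
      criticalCorr 3 2 ![ax 0, ax a] * criticalCorr 3 2 ![ax (a + b), ax (a + b + c)] *
        (criticalCorr 3 2 ![ax 0, ax (a + b + c)] * criticalCorr 3 2 ![ax a, ax (a + b)])

/-- The route decl, unfolded (the `let p := …` is definitional). -/
theorem interlacing_iff :
    SubPtolemyInterlacing.Interlacing ↔
      ∀ a b c : ℕ, 1 ≤ a → 1 ≤ b → 1 ≤ c →
        criticalCorr 3 4 ![ax 0, ax a, ax (a + b), ax (a + b + c)] *
            (criticalCorr 3 2 ![ax 0, ax (a + b)] * criticalCorr 3 2 ![ax a, ax (a + b + c)]) ≤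
          criticalCorr 3 2 ![ax 0, ax a] * criticalCorr 3 2 ![ax (a + b), ax (a + b + c)] *
            (criticalCorr 3 2 ![ax 0, ax (a + b + c)] * criticalCorr 3 2 ![ax a, ax (a + b)]) :=
  Iff.rfl

/-- Zero first gap: EQUALITY. -/
theorem spc_eq_of_a_zero (b c : ℕ) :
    criticalCorr 3 4 ![ax 0, ax 0, ax (0 + b), ax (0 + b + c)] *
        (criticalCorr 3 2 ![ax 0, ax (0 + b)] * criticalCorr 3 2 ![ax 0, ax (0 + b + c)]) =
      criticalCorr 3 2 ![ax 0, ax 0] * criticalCorr 3 2 ![ax (0 + b), ax (0 + b + c)] *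
        (criticalCorr 3 2 ![ax 0, ax (0 + b + c)] * criticalCorr 3 2 ![ax 0, ax (0 + b)]) := by
  rw [corr4_eq01, corr2_self]
  ring

/-- Zero middle gap: EQUALITY. -/
theorem spc_eq_of_b_zero (a c : ℕ) :
    criticalCorr 3 4 ![ax 0, ax a, ax (a + 0), ax (a + 0 + c)] *
        (criticalCorr 3 2 ![ax 0, ax (a + 0)] * criticalCorr 3 2 ![ax a, ax (a + 0 + c)]) =
      criticalCorr 3 2 ![ax 0, ax a] * criticalCorr 3 2 ![ax (a + 0), ax (a + 0 + c)] *
        (criticalCorr 3 2 ![ax 0, ax (a + 0 + c)] * criticalCorr 3 2 ![ax a, ax (a + 0)]) := by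
  simp only [add_zero]
  rw [corr4_eq12, corr2_self]
  ring

/-- Zero last gap: EQUALITY. -/
theorem spc_eq_of_c_zero (a b : ℕ) :
    criticalCorr 3 4 ![ax 0, ax a, ax (a + b), ax (a + b + 0)] *
        (criticalCorr 3 2 ![ax 0, ax (a + b)] * criticalCorr 3 2 ![ax a, ax (a + b + 0)]) =
      criticalCorr 3 2 ![ax 0, ax a] * criticalCorr 3 2 ![ax (a + b), ax (a + b + 0)] *
        (criticalCorr 3 2 ![ax 0, ax (a + b + 0)] * criticalCorr 3 2 ![ax a, ax (a + b)]) := by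
  simp only [add_zero]
  rw [corr4_eq23, corr2_self]
  ring

/-- **The gap hypotheses are not load-bearing**: dropping all three of `1 ≤ a`, `1 ≤ b`, `1 ≤ c` gives an
EQUIVALENT statement, because every degenerate case is an equality (`σ² = 1`). In particular no
`interlacing_false_without_gap` lemma can exist; a refutation must use three positive gaps. -/
theorem interlacingAllGaps_iff : InterlacingAllGaps ↔ SubPtolemyInterlacing.Interlacing := by
  rw [interlacing_iff]
  constructor
  · intro h a b c _ _ _
    exact h a b c
  · intro h a b c
    rcases Nat.eq_zero_or_pos a with rfl | ha
    · exact le_of_eq (spc_eq_of_a_zero b c)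
    rcases Nat.eq_zero_or_pos b with rfl | hb
    · exact le_of_eq (spc_eq_of_b_zero a c)
    rcases Nat.eq_zero_or_pos c with rfl | hc
    · exact le_of_eq (spc_eq_of_c_zero a b)
    exact h a b c ha hb hc

/-- The STRICT all-gaps strengthening. -/
def InterlacingStrictAllGaps : Prop :=
  ∀ a b c : ℕ,
    criticalCorr 3 4 ![ax 0, ax a, ax (a + b), ax (a + b + c)] *
        (criticalCorr 3 2 ![ax 0, ax (a + b)] * criticalCorr 3 2 ![ax a, ax (a + b + c)]) <
      criticalCorr 3 2 ![ax 0, ax a] * criticalCorr 3 2 ![ax (a + b), ax (a + b + c)] *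
        (criticalCorr 3 2 ![ax 0, ax (a + b + c)] * criticalCorr 3 2 ![ax a, ax (a + b)])

/-- **Tightness on the boundary of the gap octant**: the strict all-gaps form is FALSE (witness `b = 0`,
where both sides coincide). Informally the margin also closes in the interior corner `a = c = 1`,
`b → ∞` (`ρ(1,b,1) → 1⁻`, RP log-convexity `2Δ/b²` against energy exchange `b^{-2Δ_ε}`), see §E. -/
theorem not_interlacingStrictAllGaps : ¬ InterlacingStrictAllGaps := by
  intro h
  have h1 := h 1 0 1
  exact (lt_irrefl _) (lt_of_lt_of_eq h1 (spc_eq_of_b_zero 1 1).symm)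

/-! ### §B Where the margin closes: channel form and the `(1,b,1)` corner (pure algebra)

SPC `S₄P₂ ≤ P₁P₃` ⟺ `S₄/P₁ ≤ t := P₃/P₂` ⟺ `(S₄ - P₁)·P₂ ≤ P₁·(P₃ - P₂)`: the four-point EXCESS over the
adjacent pairing, weighted by the crossing pairing, must not exceed the adjacent pairing times the RP
log-convexity defect `P₃ - P₂ ≥ 0`. In the corner `a = c = 1`, `b → ∞` (translation invariance:
`P₁ = G(1)²`) this reads `Cov(σ₀σ₁, σ_{b+1}σ_{b+2})·G(b+1)² ≤ G(1)²·(G(b)G(b+2) - G(b+1)²)`: energy–energy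
covariance (`~ b^{-2Δ_ε}`, `2Δ_ε = 2.83`) against curvature (`~ 2Δ·G(b)²/b²`); the margin `1 - ρ(1,b,1) → 0⁺`
like `2Δ/b²`. Exact 2D calibration (kit j020537): `ρ(1,b,1) = 0.98617, 0.99275, …, 0.9999906 (b = 70)`, never `≥ 1`. -/

/-- Channel form of SPC: `S₄P₂ ≤ P₁P₃ ↔ (S₄ - P₁)P₂ ≤ P₁(P₃ - P₂)`. -/
theorem spc_iff_excess_le_defect (S4 P₁ P₂ P₃ : ℝ) :
    S4 * P₂ ≤ P₁ * P₃ ↔ (S4 - P₁) * P₂ ≤ P₁ * (P₃ - P₂) := by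
  constructor <;> intro h <;> nlinarith [h]

/-- Channel-ratio form: for positive pairings, `S₄P₂ ≤ P₁P₃ ↔ S₄/P₁ ≤ P₃/P₂` (`= t`, the two-point
cross-ratio `≥ 1` by reflection positivity). -/
theorem spc_iff_channel_ratio {S4 P₁ P₂ P₃ : ℝ} (hP₁ : 0 < P₁) (hP₂ : 0 < P₂) :
    S4 * P₂ ≤ P₁ * P₃ ↔ S4 / P₁ ≤ P₃ / P₂ := by
  rw [div_le_div_iff₀ hP₁ hP₂, mul_comm P₃ P₁]

/-! ### §C1 The Gaussian caricature and the threshold `log₂(1+√2)` -/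

/-- SPC for a WICK (Gaussian) four-point function `S₄ = G₁₂G₃₄ + G₁₃G₂₄ + G₁₄G₂₃` built on a
translation-invariant axial two-point function `g (distance)`; distances of the interlaced quadruple
`0 < a < a+b < a+b+c`: `d₁₂ = a`, `d₃₄ = c`, `d₁₃ = a+b`, `d₂₄ = b+c`, `d₁₄ = a+b+c`, `d₂₃ = b`. -/
def WickSPC (g : ℕ → ℝ) : Prop :=
  ∀ a b c : ℕ, 1 ≤ a → 1 ≤ b → 1 ≤ c →
    (g a * g c + g (a + b) * g (b + c) + g (a + b + c) * g b) * (g (a + b) * g (b + c)) ≤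
      g a * g c * (g (a + b + c) * g b)

/-- The scale-free two-point function `n ↦ n^{-s}`. -/
def powG (s : ℝ) (n : ℕ) : ℝ := (n : ℝ) ^ (-s)

theorem powG_pos (s : ℝ) {n : ℕ} (hn : 0 < n) : 0 < powG s n :=
  Real.rpow_pos_of_pos (by exact_mod_cast hn) _

theorem powG_one (s : ℝ) : powG s 1 = 1 := by simp [powG]

theorem powG_mul (s : ℝ) (m n : ℕ) : powG s (m * n) = powG s m * powG s n := by
  simp only [powG, Nat.cast_mul]
  exact Real.mul_rpow (Nat.cast_nonneg m) (Nat.cast_nonneg n)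

/-- `x ↦ 2^{-s}` versus the silver ratio: `2^{-s}(2 + 2^{-s}) ≤ 1 ↔ log₂(1+√2) ≤ s`. -/
theorem two_rpow_neg_key_iff (s : ℝ) :
    powG s 2 * (2 + powG s 2) ≤ 1 ↔ Real.logb 2 (1 + Real.sqrt 2) ≤ s := by
  have h2 : (0 : ℝ) < 2 := by norm_num
  have hs2 : Real.sqrt 2 ^ 2 = 2 := Real.sq_sqrt h2.le
  have hs0 : 0 ≤ Real.sqrt 2 := Real.sqrt_nonneg 2
  have ht : 0 < (2 : ℝ) ^ s := Real.rpow_pos_of_pos h2 s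
  have hx : powG s 2 = ((2 : ℝ) ^ s)⁻¹ := by
    simp only [powG, Nat.cast_ofNat]
    exact Real.rpow_neg h2.le s
  rw [Real.logb_le_iff_le_rpow (by norm_num : (1 : ℝ) < 2) (by positivity), hx]
  set t : ℝ := (2 : ℝ) ^ s with ht_def
  have hsq : (1 : ℝ) < Real.sqrt 2 := by nlinarith [hs2, hs0]
  constructor
  · intro h
    -- `t⁻¹ (2 + t⁻¹) ≤ 1` gives `2t + 1 ≤ t²`, i.e. `(t-1)² ≥ 2`, and `t > 0` forces `t ≥ 1 + √2`.
    have h' : 2 * t + 1 ≤ t ^ 2 := by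
      have e1 : t⁻¹ * (2 + t⁻¹) * t ^ 2 = 2 * t + 1 := by field_simp
      have := mul_le_mul_of_nonneg_right h (sq_nonneg t)
      rw [e1, one_mul] at this
      exact this
    by_contra hcon
    have hlt : t < 1 + Real.sqrt 2 := lt_of_not_ge hcon
    have hprod : 0 < (1 + Real.sqrt 2 - t) * (t - 1 + Real.sqrt 2) :=
      mul_pos (sub_pos.mpr hlt) (by linarith)
    nlinarith [hprod, hs2, h']
  · intro h
    have h' : 2 * t + 1 ≤ t ^ 2 := by nlinarith [hs2, hs0, ht, h]
    have e1 : t⁻¹ * (2 + t⁻¹) = (2 * t + 1) / t ^ 2 := by field_simp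
    rw [e1, div_le_one (by positivity)]
    exact h'

/-- **Gaussian threshold at the balanced quadruple.** For the Wick law on `n^{-s}`, SPC at the
Ptolemy-balanced axis quadruple `(0,2,3,6)·e₁` (gaps `(2,1,3)`, cross-ratio `z = ½`) holds
IFF `log₂(1+√2) ≤ s` (`≈ 1.2716`). With `x = 2^{-s}`, `y = 3^{-s}` the two sides are
`x³y²(2+x)` and `x²y²`. -/
theorem wickSPC_pow_balanced_iff (s : ℝ) :
    (powG s 2 * powG s 3 + powG s 3 * powG s 4 + powG s 6 * powG s 1) * (powG s 3 * powG s 4) ≤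
        powG s 2 * powG s 3 * (powG s 6 * powG s 1) ↔
      Real.logb 2 (1 + Real.sqrt 2) ≤ s := by
  rw [← two_rpow_neg_key_iff]
  have h4 : powG s 4 = powG s 2 * powG s 2 := by rw [← powG_mul]
  have h6 : powG s 6 = powG s 2 * powG s 3 := by rw [← powG_mul]
  rw [h4, h6, powG_one]
  have hx := powG_pos s (n := 2) (by norm_num)
  have hy := powG_pos s (n := 3) (by norm_num)
  set x := powG s 2
  set y := powG s 3
  have hxy : 0 < x ^ 2 * y ^ 2 := by positivity
  constructor
  · intro h
    by_contra h'
    have h'' : 1 < x * (2 + x) := lt_of_not_ge h'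
    have : x ^ 2 * y ^ 2 * 1 < x ^ 2 * y ^ 2 * (x * (2 + x)) := mul_lt_mul_of_pos_left h'' hxy
    nlinarith [this, h]
  · intro h
    have : x ^ 2 * y ^ 2 * (x * (2 + x)) ≤ x ^ 2 * y ^ 2 * 1 := mul_le_mul_of_nonneg_left h hxy.le
    nlinarith [this]

/-- **The Gaussian analog of the crux fails throughout the route's window.** For every exponent
`s < log₂(1+√2)` — in particular `s = 1` (the `ℤ³` massless GFF / mean-field `η = 0` in `d = 3`) and
`s = 2Δ` for any `Δ` allowed by the sibling crux `SubPtolemyFloor` — the Wick law on `n^{-s}` violates SPC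
at the gaps `(2,1,3)`. Hence `Interlacing` cannot follow from any property shared with these Gaussian laws
(GKS, reflection positivity, Gaussian domination, Lebowitz/Newman-type pairing-SUM bounds). -/
theorem not_wickSPC_pow_of_lt_threshold {s : ℝ} (hs : s < Real.logb 2 (1 + Real.sqrt 2)) :
    ¬ WickSPC (powG s) := by
  intro h
  have h213 := h 2 1 3 (by norm_num) (by norm_num) (by norm_num)
  norm_num at h213
  exact (not_le.mpr hs) ((wickSPC_pow_balanced_iff s).mp h213)

/-- The `ℤ³`-GFF exponent `s = 1` (`G ~ 1/|x|`): the Gaussian analog of the crux is FALSE. -/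
theorem not_wickSPC_pow_one : ¬ WickSPC (powG 1) :=
  not_wickSPC_pow_of_lt_threshold SubPtolemyFloorNegative.one_lt_threshold

/-- In the window of the sibling crux (`2Δ < log₂(1+√2)`) the Gaussian analog is FALSE. -/
theorem not_wickSPC_pow_two_mul_of_window {Δ : ℝ} (hΔ : 2 * Δ < Real.logb 2 (1 + Real.sqrt 2)) :
    ¬ WickSPC (powG (2 * Δ)) :=
  not_wickSPC_pow_of_lt_threshold hΔ

/-- Above the threshold the balanced instance HOLDS for the Wick law, e.g. at the mean-field exponent
`s = 2` of `d = 4` (`2Δ = d - 2`): the dimension dependence of the route enters only through `s`. -/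
theorem wickSPC_pow_two_balanced :
    (powG 2 2 * powG 2 3 + powG 2 3 * powG 2 4 + powG 2 6 * powG 2 1) * (powG 2 3 * powG 2 4) ≤
      powG 2 2 * powG 2 3 * (powG 2 6 * powG 2 1) :=
  (wickSPC_pow_balanced_iff 2).mpr SubPtolemyFloorNegative.threshold_lt_two.le

/-! ### §C2 Calibration on chains (trees): equality, and the interlaced slot is load-bearing -/

/-- SPC is an IDENTITY for every multiplicative axial law `G(i,j) = t^{j-i}`, `S₄ = t^{a} t^{c}`
(nearest-neighbour Ising chain, any tree; `t = tanh β`). -/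
theorem chain_spc_eq (t : ℝ) (a b c : ℕ) :
    t ^ a * t ^ c * (t ^ (a + b) * t ^ (b + c)) = t ^ a * t ^ c * (t ^ (a + b + c) * t ^ b) := by
  ring

/-- Penalising the ADJACENT pairing `(12)(34)` instead of the crossing one is FALSE already on the chain
(`t = 1/2`, gaps `(1,1,1)`: `t⁴ ≤ t⁸` fails): the cyclic/interlaced assignment of the pairings is
load-bearing. -/
theorem not_chain_adjacentPenalised :
    ¬ ∀ (t : ℝ), 0 < t → t < 1 → ∀ a b c : ℕ, 1 ≤ a → 1 ≤ b → 1 ≤ c →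
      t ^ a * t ^ c * (t ^ a * t ^ c) ≤ t ^ (a + b) * t ^ (b + c) * (t ^ (a + b + c) * t ^ b) := by
  intro h
  have := h (1 / 2) (by norm_num) (by norm_num) 1 1 1 le_rfl le_rfl le_rfl
  norm_num at this

/-! ### §C3 Off the line: equidistant quadruples

If all six two-point values of a quadruple coincide (`G > 0`; e.g. the lattice "regular tetrahedron"
`{0, e₁+e₂, e₁+e₃, e₂+e₃} ⊂ ℤ³`, one orbit of the point group), the sub-Ptolemy inequality with ANY choice
of penalised pairing forces `S₄ ≤ G²`, i.e. together with Griffiths II (`S₄ ≥ G²`) exact factorisation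
`S₄ = G²`, `U₄ = -2G²`, meeting probability `1`. So the off-line / non-concyclic extension of the crux is not a
candidate strengthening (the continuum face `g(u,v) ≤ v^{-Δ}` fails at `u = v = 1` for every unitary CFT). -/

/-- Equidistant quadruples: SPC collapses to `S₄ ≤ G²` (pure algebra). -/
theorem spc_equidistant_iff {G S4 : ℝ} (hG : 0 < G) :
    S4 * (G * G) ≤ G * G * (G * G) ↔ S4 ≤ G * G := by
  have h : 0 < G * G := mul_pos hG hG
  rw [mul_le_mul_iff_left₀ h]

/-! ### §D Targets — line `prover-line-stmt-CriticalPhenomena-15702-0` (stubs registered 2026-08-16T22:21Z)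

Registered stubs (ledger `workitem stubs`): `stub_monotone` (`G(a+b)G(b+c) ≤ G(a)G(c)`, all `a b c : ℕ`),
`stub_logConvex` (`G(a+b)G(b+c) ≤ G(a+b+c)G(b)`), `stub_lebowitzRegime` (`2P₂² ≤ (P₁-P₂)(P₃-P₂) → SPC`),
`stub_boxSwitching` (free-box identity `S₄ = P₁+P₂+P₃ - 2P₂·P^{13,24}_L[x₁ ↔ x₂]`, `a+b+c ≤ L`),
`stub_boxLimit` (eventual free-box SPC ⇒ SPC for `criticalCorr 3`), `stub_engine` (for `a,b,c ≥ 1`, monotone →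
logConvex → NOT Lebowitz regime → eventually in `L` the free-box meeting form
`P₂(P₁+P₂+P₃) - P₁P₃ ≤ 2P₂²·P^{13,24}_L[x₁ ↔ x₂]`).

Disprover's checks (no stub broken):
* degenerate gaps — every stub quantifies over all of `ℕ³`; with `isingTwoPoint x x = 1`, `criticalTwoPoint 0 = 1`
  (spin PAIR products) and reflexive `openConn x x`, all zero-gap instances are equalities / GKS instances:
  `stub_monotone` at `a = 0` is `G(b)G(b+c) ≤ G(c)` (MMS + `G ≤ 1`), `stub_logConvex` at `b = 0` is Griffiths II
  `G(a)G(c) ≤ G(a+c)`; `stub_boxSwitching` at `a = 0 / b = 0 / c = 0 / a = b = 0 (A = ∅)` reduces to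
  `⟨σσ⟩ = ⟨σσ⟩` because the relevant connection event has probability `1` (sources force it) — consistent,
  PROVIDED the tree proves `P^{A,B}_L[x ↔ y] = 1` when `{x,y}` is joined through the sources (`{x₁}∆{x₃}` with
  `x₂ ∈` the forced cluster); the lead should check that `sourcedDoubleCurrentLaw 3 L β ∅ B` is the intended
  probability measure (docstring: junk `0` only if sources are infeasible; `∅` is feasible).
* truth — `stub_monotone` = Messager–Miracle-Solé axial monotonicity + GKS I; `stub_logConvex` = reflection
  positivity through site AND bond planes (`n ↦ G(n e₁)` is a Hausdorff moment sequence on `ℕ`, incl. `n = 0`);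
  `stub_lebowitzRegime` = Lebowitz `U₄ ≤ 0` + algebra (`P₂ΣP ≤ P₁P₃ ⇔ (P₁-P₂)(P₃-P₂) ≥ 2P₂²`);
  `stub_boxSwitching` = ADC21 (3.11) in the free box (volumes match: `freeBoxGraph 3 L` has bond set `ℰ_{Λ_L}`);
  `stub_boxLimit` = free = plus at `β_c(3)` (ADS15) + limits of products. All plausible theorems.
* `stub_engine` IS the crux (finite volume, outside the Lebowitz corner): joint sufficiency is honest, no gap is
  smuggled, but nothing got easier. `engine_inputs_insufficient` below: the engine's displayed inputs
  (monotone, log-convex, non-Lebowitz regime) together with GKS II and Lebowitz do NOT imply its conclusion with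
  meeting probability `0` — numerically consistent data violate it (the Wick point of §C1) — so the engine must
  produce a QUANTITATIVE lower bound on the meeting probability `I× ≥ ι*(a,b,c) = 1 - (u-1)(t-1)/2 ∈ (0, 0.448]`
  at `β_c(3)`; cf. ideator k2's second-moment ceiling `≤ 0.42 < ι*` (kit j020292): moment methods cannot reach it. -/

/-- **The engine's displayed inputs are insufficient.** There are pairing weights `P₁, P₂, P₃ > 0` and a
four-point value `S₄` satisfying MMS monotonicity (`P₂ ≤ P₁`), RP log-convexity (`P₂ ≤ P₃`), Griffiths II
(`S₄ ≥ each pairing`), Lebowitz (`S₄ ≤ P₁+P₂+P₃`) and the non-Lebowitz-regime hypothesis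
`(P₁-P₂)(P₃-P₂) < 2P₂²`, for which SPC FAILS (`P₁P₃ < S₄P₂`). Witness: the Wick values at gaps `(2,1,3)` with
`G(n) = 1/n`: `P₁ = P₃ = 1/6`, `P₂ = 1/12`, `S₄ = 5/12`. -/
theorem engine_inputs_insufficient :
    ∃ P₁ P₂ P₃ S4 : ℝ, 0 < P₂ ∧ P₂ ≤ P₁ ∧ P₂ ≤ P₃ ∧ P₁ ≤ S4 ∧ P₂ ≤ S4 ∧ P₃ ≤ S4 ∧
      S4 ≤ P₁ + P₂ + P₃ ∧ (P₁ - P₂) * (P₃ - P₂) < 2 * P₂ ^ 2 ∧ P₁ * P₃ < S4 * P₂ :=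
  ⟨1 / 6, 1 / 12, 1 / 6, 5 / 12, by norm_num⟩

/-! ### §E Near-misses and why the crux resists (prose; numbers from kit jobs) -/

/-- Placeholder carrying the numerical record in its docstring (updated as jobs return).

WHY NO STRUCTURAL KILL: (i) OPE corners are safe with room — `b ≫ a,c`: excess `~(ac/b²)^{Δ_ε}` vs
two-point slack `2Δ·ac/b²` and `Δ_ε = 1.41 > 1`; `b ≪ a,c`: excess `~n^{-Δ_ε}` vs slack `4Δ/n`;
(ii) the only corner with VANISHING margin is `a = c = 1, b → ∞`, where the sign is fixed by RP
log-convexity (`G(b+1)² ≤ G(b)G(b+2)`, deficit `≈ 2Δ/b²`) beating the energy–energy exchange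
`Cov(σ₀σ₁, σ_{b+1}σ_{b+2}) ~ b^{-2Δ_ε} = b^{-2.83}`; (iii) the continuum value
`ρ_∞(z) = g(z,z)(1-z)^{2Δ}` is symmetric under `z ↔ 1-z` and ≈ 0.85 at `z = ½` (bootstrap data);
so a violation, if any, sits at INTERMEDIATE lattice gaps, which only Monte Carlo sees (below).
Regimes where SPC is genuinely false and why they do not transfer: `β > β_c` (LRO doublet,
`LHS − RHS ≈ 2m⁶(g₁₃+g₂₄) > 0`); quasi-1D cylinders above their crossover (kit j020182, ideator k2);
Gaussian laws with `s < 1.2716` (§C1). -/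
theorem numerics_summary : True := trivial

/-! ### §F Region counterexamples (gen 2): SPC is not a finite-graph inequality

The certificates live in `Theorems/Interlacing/Negative/RegionCounterexample.lean` (`Λ_Z` as a pair ferromagnet on
`Fin 10`, `decide +kernel`: `gksExpect_zRegion_interlacing_reversed` at `K ≡ artanh(1/5)`, `…_7_32`, `…_one_hundredth`,
and the `ℝ`-free rational forms `isingExpect_zRegion_interlacing_reversed_*`) and `…/RegionCounterexampleZ3.lean`
(transport to `isingExpect (zdGraph 3) Λ_Z β 0 .free` along `Fin 10 ↪ ℤ³`). Re-indexed here in the exact shape of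
`Sketch.stub_engine`'s conclusion with the box replaced by a region. -/

/-- **The region-general strengthening of box-SPC is false** (re-export of the landed
`InterlacingNegative.not_interlacing_freeRegion`, p140065): it is NOT true that for every finite `Λ ⊂ ℤ³` containing the
axis segment, every `β > 0` and all gaps `a,b,c ≥ 1` the free-boundary state `⟨·⟩^∅_{Λ;β}` satisfies
`S₄·(G₁₃G₂₄) ≤ G₁₂G₃₄·(G₁₄G₂₃)`; witness `Λ_Z`, `β = artanh(1/5)`, gaps `(1,1,1)`. [folklore] -/
theorem regionGeneral_boxSPC_false :
    ¬ ∀ (Λ : Finset (Site 3)) (β : ℝ) (a b c : ℕ), 0 < β → 1 ≤ a → 1 ≤ b → 1 ≤ c →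
        (∀ k : ℕ, k ≤ a + b + c → (Pi.single 0 (k : ℤ) : Site 3) ∈ Λ) →
        isingExpect (zdGraph 3) Λ β 0 .free
              (spinMonomial ![(Pi.single 0 ((0 : ℕ) : ℤ)), (Pi.single 0 ((a : ℕ) : ℤ)),
                (Pi.single 0 ((a + b : ℕ) : ℤ)), (Pi.single 0 ((a + b + c : ℕ) : ℤ))]) *
            (isingTwoPoint (zdGraph 3) Λ β 0 .free (Pi.single 0 ((0 : ℕ) : ℤ)) (Pi.single 0 ((a + b : ℕ) : ℤ)) *
              isingTwoPoint (zdGraph 3) Λ β 0 .free (Pi.single 0 ((a : ℕ) : ℤ)) (Pi.single 0 ((a + b + c : ℕ) : ℤ))) ≤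
          isingTwoPoint (zdGraph 3) Λ β 0 .free (Pi.single 0 ((0 : ℕ) : ℤ)) (Pi.single 0 ((a : ℕ) : ℤ)) *
              isingTwoPoint (zdGraph 3) Λ β 0 .free (Pi.single 0 ((a + b : ℕ) : ℤ)) (Pi.single 0 ((a + b + c : ℕ) : ℤ)) *
            (isingTwoPoint (zdGraph 3) Λ β 0 .free (Pi.single 0 ((0 : ℕ) : ℤ)) (Pi.single 0 ((a + b + c : ℕ) : ℤ)) *
              isingTwoPoint (zdGraph 3) Λ β 0 .free (Pi.single 0 ((a : ℕ) : ℤ)) (Pi.single 0 ((a + b : ℕ) : ℤ))) :=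
  InterlacingNegative.not_interlacing_freeRegion

/-! ### §G Balanced family versus all gaps: merging form, strictness, and the separation -/

/-- **Merging form of SPC.** With `S₄ = P₁ + P₂ + P₃ − 2P₂·I` (the box switching identity `stub_boxSwitching`,
`I` = merging probability of the two interlaced sourced double currents):
`S₄·P₂ ≤ P₁·P₃ ↔ 2P₂²(1 − I) ≤ (P₁ − P₂)(P₃ − P₂)`, i.e. `I ≥ ι* := 1 − (u−1)(t−1)/2`. [folklore] -/
theorem spc_iff_merging (P₁ P₂ P₃ I : ℝ) :
    (P₁ + P₂ + P₃ - 2 * P₂ * I) * P₂ ≤ P₁ * P₃ ↔ 2 * P₂ ^ 2 * (1 - I) ≤ (P₁ - P₂) * (P₃ - P₂) := by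
  constructor <;> intro h <;> nlinarith [h]

/-- The Wick point `I = 0`: `(P₁+P₂+P₃)·P₂ ≤ P₁P₃ ↔ 2P₂² ≤ (P₁−P₂)(P₃−P₂)` (`(u−1)(t−1) ≥ 2`; for the power law
`n^{-s}`: `u = z^{-s}`, `t = (1−z)^{-s}`, `z` the cross-ratio — §G′ of the module docstring). [folklore] -/
theorem wickSPC_iff_defects (P₁ P₂ P₃ : ℝ) :
    (P₁ + P₂ + P₃) * P₂ ≤ P₁ * P₃ ↔ 2 * P₂ ^ 2 ≤ (P₁ - P₂) * (P₃ - P₂) := by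
  constructor <;> intro h <;> nlinarith [h]

/-- The threshold form used by the line (`ι*`): for `P₂ > 0`,
`(P₁+P₂+P₃ − 2P₂·I)·P₂ ≤ P₁P₃ ↔ ι* := 1 − (u−1)(t−1)/2 ≤ I` with `u = P₁/P₂`, `t = P₃/P₂`. [folklore] -/
theorem spc_iff_iotaStar {P₁ P₂ P₃ I : ℝ} (hP₂ : 0 < P₂) :
    (P₁ + P₂ + P₃ - 2 * P₂ * I) * P₂ ≤ P₁ * P₃ ↔ 1 - (P₁ / P₂ - 1) * (P₃ / P₂ - 1) / 2 ≤ I := by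
  rw [spc_iff_merging]
  have hP2 : 0 < P₂ ^ 2 := pow_pos hP₂ 2
  have key : (P₁ / P₂ - 1) * (P₃ / P₂ - 1) = (P₁ - P₂) * (P₃ - P₂) / P₂ ^ 2 := by
    field_simp
  rw [key]
  constructor
  · intro h
    have h' : 2 * (1 - I) ≤ (P₁ - P₂) * (P₃ - P₂) / P₂ ^ 2 := by
      rw [le_div_iff₀ hP2]; linarith
    linarith
  · intro h
    have h' : 2 * (1 - I) ≤ (P₁ - P₂) * (P₃ - P₂) / P₂ ^ 2 := by linarith
    rw [le_div_iff₀ hP2] at h'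
    linarith

/-- The Wick point in cross-ratio variables: for `P₂ > 0`, `(P₁+P₂+P₃)·P₂ ≤ P₁P₃ ↔ 2 ≤ (u−1)(t−1)`; for the power law `n^{-s}`
one has `u = z^{-s}`, `t = (1−z)^{-s}` (`z = ac/((a+b)(b+c))`, `1 − z = b(a+b+c)/((a+b)(b+c))`), so the Gaussian threshold is a
function of the cross-ratio alone (§G′). [folklore] -/
theorem wickSPC_iff_ut {P₁ P₂ P₃ : ℝ} (hP₂ : 0 < P₂) :
    (P₁ + P₂ + P₃) * P₂ ≤ P₁ * P₃ ↔ 2 ≤ (P₁ / P₂ - 1) * (P₃ / P₂ - 1) := by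
  have h := spc_iff_iotaStar (P₁ := P₁) (P₃ := P₃) (I := 0) hP₂
  simp only [mul_zero, sub_zero] at h
  rw [h]
  constructor <;> intro h' <;> linarith

/-- The cross-ratio bookkeeping of an interlaced axis quadruple with gaps `(a,b,c)`:
`1 − ac/((a+b)(b+c)) = b(a+b+c)/((a+b)(b+c))`. [folklore] -/
theorem one_sub_crossRatio {a b c : ℝ} (hab : a + b ≠ 0) (hbc : b + c ≠ 0) :
    1 - a * c / ((a + b) * (b + c)) = b * (a + b + c) / ((a + b) * (b + c)) := by
  field_simp
  ring

/-- **Every instance with merging probability `< 1` needs STRICT two-point inequalities.** If `P₂ > 0`, `P₂ ≤ P₁`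
(MMS) and `I < 1`, then SPC forces `P₂ < P₁` and `P₂ < P₃` strictly — quantitatively
`(P₁−P₂)(P₃−P₂) ≥ 2P₂²(1−I) > 0`. Reflection positivity / MMS deliver only `≤`; a lower bound on `t − 1` at `β_c(3)` is
in no landed or printed fact (information for the line: this is load-bearing for balanced AND band instances).
[folklore] -/
theorem spc_forces_strict {P₁ P₂ P₃ I : ℝ} (hP₂ : 0 < P₂) (hI : I < 1) (hu : P₂ ≤ P₁)
    (h : (P₁ + P₂ + P₃ - 2 * P₂ * I) * P₂ ≤ P₁ * P₃) : P₂ < P₁ ∧ P₂ < P₃ := by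
  rw [spc_iff_merging] at h
  have h0 : 0 < 2 * P₂ ^ 2 * (1 - I) := mul_pos (mul_pos (by norm_num) (pow_pos hP₂ 2)) (sub_pos.mpr hI)
  have hpos : 0 < (P₁ - P₂) * (P₃ - P₂) := lt_of_lt_of_le h0 h
  rcases hu.lt_or_eq with hlt | heq
  · refine ⟨hlt, ?_⟩
    rcases pos_and_pos_or_neg_and_neg_of_mul_pos hpos with ⟨_, h2⟩ | ⟨h1, _⟩
    · exact sub_pos.mp h2
    · exact absurd h1 (not_lt.mpr (sub_nonneg.mpr hu))
  · exfalso
    rw [heq, sub_self, zero_mul] at hpos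
    exact lt_irrefl _ hpos

/-- **The balanced family plus every landed two-point fact does not carry the other gaps** (re-export of the landed
`InterlacingNegative.not_allGaps_of_balanced_and_twoPointFacts`, p140878 — the lead's `disprover-wanted`): for axial
two-point data `G` (`G 0 = 1`, `0 < G ≤ 1`, antitone, MMS shape, GLOBAL log-convexity, envelope `1/(3n²) ≤ G ≤ 1/n`)
and reversal-symmetric four-point data `S` with Griffiths II, Lebowitz and the switching range, SPC at all balanced
shapes `(2N, N, 3N)` does NOT imply SPC at all gaps; the witness has merging probability `9/10` everywhere and fails at
`(1,1,1)` because `t(1,1,1) = 1`. [folklore] -/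
theorem balancedFamily_insufficient :
    ¬ ∀ (G : ℕ → ℝ) (S : ℕ → ℕ → ℕ → ℝ),
        G 0 = 1 → (∀ n, 0 < G n) → (∀ n, G n ≤ 1) → (∀ n, G (n + 1) ≤ G n) →
        (∀ a b c : ℕ, G (a + b) * G (b + c) ≤ G a * G c) →
        (∀ a b c : ℕ, G (a + b) * G (b + c) ≤ G (a + b + c) * G b) →
        (∀ n : ℕ, 1 ≤ n → 1 / (3 * (n : ℝ) ^ 2) ≤ G n ∧ G n ≤ 1 / n) →
        (∀ a b c : ℕ, S a b c = S c b a) →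
        (∀ a b c : ℕ, G a * G c ≤ S a b c ∧ G (a + b) * G (b + c) ≤ S a b c ∧ G (a + b + c) * G b ≤ S a b c) →
        (∀ a b c : ℕ, S a b c ≤ G a * G c + G (a + b) * G (b + c) + G (a + b + c) * G b) →
        (∀ a b c : ℕ, G a * G c + G (a + b + c) * G b - G (a + b) * G (b + c) ≤ S a b c) →
        (∀ N : ℕ, 1 ≤ N →
          S (2 * N) N (3 * N) * (G (2 * N + N) * G (N + 3 * N)) ≤
            G (2 * N) * G (3 * N) * (G (2 * N + N + 3 * N) * G N)) →
        ∀ a b c : ℕ, 1 ≤ a → 1 ≤ b → 1 ≤ c →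
          S a b c * (G (a + b) * G (b + c)) ≤ G a * G c * (G (a + b + c) * G b) :=
  InterlacingNegative.not_allGaps_of_balanced_and_twoPointFacts

/-- The merging threshold of the balanced shapes in the Gaussian caricature is the sibling crux's threshold: at
`z = ½` (`u = t = 2^s`) the Wick condition `2 ≤ (u−1)(t−1)` is `(2^s − 1)² ≥ 2`, i.e. `s ≥ log₂(1+√2)` — so the
restated (balanced) crux keeps ALL the anti-Gaussian content of the original (gen 1 §C1, `wickSPC_pow_balanced_iff`).
Pure algebra: `2 ≤ (τ−1)² ↔ 1 + √2 ≤ τ` for `τ ≥ 1`. [folklore] -/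
theorem balanced_wick_threshold {τ : ℝ} (hτ : 1 ≤ τ) : 2 ≤ (τ - 1) * (τ - 1) ↔ 1 + Real.sqrt 2 ≤ τ := by
  have hs2 : Real.sqrt 2 * Real.sqrt 2 = 2 := Real.mul_self_sqrt (by norm_num)
  have hs0 : 0 ≤ Real.sqrt 2 := Real.sqrt_nonneg 2
  constructor
  · intro h
    by_contra hcon
    have hlt : τ - 1 < Real.sqrt 2 := by linarith [lt_of_not_ge hcon]
    have h1 : 0 ≤ τ - 1 := by linarith
    have : (τ - 1) * (τ - 1) < Real.sqrt 2 * Real.sqrt 2 := mul_lt_mul'' hlt hlt h1 h1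
    linarith
  · intro h
    have h1 : Real.sqrt 2 ≤ τ - 1 := by linarith
    have : Real.sqrt 2 * Real.sqrt 2 ≤ (τ - 1) * (τ - 1) := mul_le_mul h1 h1 hs0 (by linarith)
    linarith

/-! ### §H Targets — line `Sketch` after cycle c1-1 (restatement proposed; `stub_engineBalanced` prepared)

No stub broken. Status of the disprover's attacks on the ONE open stub (`stub_engine` ≡ `stub_cageScreening`; prepared
balanced variant `SketchBalanced.stub_engineBalanced`, not yet registered):
* region-general version — REFUTED (§F; landed). Balanced shape included (pendant transport of `Λ_Z`).
* "displayed inputs suffice" — REFUTED abstractly (gen 1 `engine_inputs_insufficient`), for a whole consistent family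
  with balanced SPC (§G `balancedFamily_insufficient`, landed), and by a genuine Ising region from `tanh β ≈ 0.4`
  (`Λ_R`, §F; exact rationals, kernel certificate size-limited).
* the stub / restated stub at `β_c(3)` in boxes — RESISTS: not decidable by any certified computation available
  (no rigorous numerics at `β_c(3)`); MC margins ≥ 15 % at balanced shapes at every measured scale, `(1,b,1)` corner
  protected (`2Δ/b²` vs `b^{-2Δ_ε}`) and Lebowitz-covered from `b ≈ 6`; regimes where SPC is genuinely false
  (`β > β_c` LRO doublet, thin super-critical cylinders, Gaussian `s < 1.2716`, bypass regions) are all excluded by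
  the letter of the stub (free b.c., full box `Λ_L`, `β = β_c(3)`, eventually in `L`).
* what any proof must do (accumulated): use `σ² = 1` quantitatively (§C1), use `β ≤ β_c` of the BULK (cylinders), use
  the box geometry quantitatively (§F), and produce STRICT `u_L, t_L > 1` with a margin `≥ 2(1 − I_L)·P₂²/…` (§G) —
  equivalently a merging floor `I×_L ≥ ι*_L ≈ 0.33 (N=1) … 0.448 (N→∞)` at `z = ½`, uniformly in the scale.
-/

end Summit.CriticalPhenomena.Ising3DConformalLimit.Cruxes.Interlacing.Disproof
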